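import Summits.CriticalPhenomena.PercolationContinuityZ3.Theorems.Transplant.FKConnectivityAllQAntipodalTwoSpineDefs
import HarnessLib

/-!
# Connectivity correlation inequalities for `φ_{w,q}` — TWO-SPINE word model: the JANUS CELLS of the root coefficient and their ATOMS

Helper file (`--supports stmt-CriticalPhenomena-4575`), FK sub-lane `prim-bschramm-fk-2` (gen 15); builds on p205010 (kernel theorem,
internal audit signed; external expert review pending).  No named facts, no sorries, standard axioms.

Memo `bschramm/FROM-fk-2-g15-TWO-SPINE.md` §10.2/§10.8/§11: the root coefficient `theta q .W (o,o,o,o) u v` of the two-spine word inequality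
(`FK.TwoSpine.DStmt` at the root diagram) is the sum of TWO SIGNED MONOMIAL CELLS, `j = true` (the marked edge `y` in `γ`, `z` in
`γᶜ`) and `j = false` (the other way round): `q^{base} · (q^{2-δ₁-δ₂}·sign₁ + q^{2-δ₁'-δ₂'}·sign₂)` (`theta_W_root`), with `sign ∈ {-1,0,1}`
(`cellSign`) and the two `δ`'s the `rowDel`s of the rows carrying the marked edges (`cellDelA`, `cellDelB`).  The ATOM identity
`q^{2-δ₁-δ₂} = (q + (1-q)δ₁)(q + (1-q)δ₂)` (`pow_two_sub_del`) splits each cell into the four pieces `(1-q)^{a+b} q^{2-a-b}`,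
`(a,b) ≤ (δ₁,δ₂)`, on which the explicit two-spine RULE of memo §11 acts (Theorem U's injection on whole cells, gen 13's word-Hall `ι`
and Theorem U on `A∖y` on atoms).  This file is the first brick of the word-level rule theorem (blueprint `prim-bschramm-fk-2-g15/BLUEPRINT-U11-LEAN.md`, L2.0).
[cite: Grimmett2006, §3.8 (pp. 61–62); §3.9 (p. 63)]
-/

noncomputable section

namespace Summit.CriticalPhenomena.PercolationContinuityZ3.Theorems

namespace FK

namespace TwoSpine

open X2Word

/-! ### The two Janus cells of a word pair (series top, all rows open) -/

/-- Real `0/1` of a Boolean. [folklore] -/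
def bR (b : Bool) : ℝ := if b then 1 else 0

/-- SIGN of the Janus cell `j` of the word pair `(u, v)` at a series top: `j = true` is the case `y ∈ γ, z ∈ γᶜ`
(`c•(α)c(β) - c(ᾱ)c•(β̄)`), `j = false` the case `z ∈ γ, y ∈ γᶜ` (`c(α)c•(β) - c•(ᾱ)c(β̄)`); values in `{-1, 0, 1}`. [folklore] -/
def cellSign (j : Bool) (u v : List SLetter) : ℝ :=
  if j then bR (rowCdot (sRowA u)) * bR (rowC (sRowA v)) - bR (rowC (sRowB u)) * bR (rowCdot (sRowB v))
  else bR (rowC (sRowA u)) * bR (rowCdot (sRowA v)) - bR (rowCdot (sRowB u)) * bR (rowC (sRowB v))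

/-- `δ` of the `A`-row that carries the marked edge `y` in cell `j` (`γ`-row for `j = true`, `γᶜ`-row for `j = false`). [folklore] -/
def cellDelA (j : Bool) (u : List SLetter) : ℕ := if j then rowDel (sRowA u) else rowDel (sRowB u)

/-- `δ` of the `B`-row that carries the marked edge `z` in cell `j` (`γᶜ`-row for `j = true`, `γ`-row for `j = false`). [folklore] -/
def cellDelB (j : Bool) (v : List SLetter) : ℕ := if j then rowDel (sRowB v) else rowDel (sRowA v)

/-- `rowDel ≤ 1`. [folklore] -/
theorem rowDel_le_one (r : List Kind) : rowDel r ≤ 1 := by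
  unfold rowDel; split <;> simp

/-- `cellDelA ≤ 1`. [folklore] -/
theorem cellDelA_le_one (j : Bool) (u : List SLetter) : cellDelA j u ≤ 1 := by
  unfold cellDelA; split <;> exact rowDel_le_one _

/-- `cellDelB ≤ 1`. [folklore] -/
theorem cellDelB_le_one (j : Bool) (v : List SLetter) : cellDelB j v ≤ 1 := by
  unfold cellDelB; split <;> exact rowDel_le_one _

/-- In the open mode all shifts vanish: the base exponent is the total `corr` of the four rows. [folklore] -/
theorem baseExp_root (u v : List SLetter) :
    baseExp (Mode.o, Mode.o, Mode.o, Mode.o) u v = rowCorr (sRowA u) + rowCorr (sRowB u) + rowCorr (sRowA v) + rowCorr (sRowB v) := by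
  simp [baseExp, Mode.shift]

/-- **The root coefficient is the sum of its two Janus cells** (series top):
`Θ(u,v) = q^{base}·(q^{2-δ₁-δ₂}·sign(true) + q^{2-δ₁'-δ₂'}·sign(false))`. [folklore] -/
theorem theta_W_root (q : ℝ) (u v : List SLetter) :
    theta q .W (Mode.o, Mode.o, Mode.o, Mode.o) u v =
      q ^ baseExp (Mode.o, Mode.o, Mode.o, Mode.o) u v *
        (q ^ (2 - cellDelA true u - cellDelB true v) * cellSign true u v +
          q ^ (2 - cellDelA false u - cellDelB false v) * cellSign false u v) := by
  simp only [theta, Mode.conn, Mode.connDot, Mode.del, cellSign, cellDelA, cellDelB, bR, if_true, if_false,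
    Bool.false_eq_true]

/-- The cell sign takes values in `{-1, 0, 1}`. [folklore] -/
theorem cellSign_mem (j : Bool) (u v : List SLetter) : cellSign j u v = -1 ∨ cellSign j u v = 0 ∨ cellSign j u v = 1 := by
  unfold cellSign bR
  split <;> split <;> split <;> split <;> split <;> norm_num

/-! ### Atoms: `q^{2-δ₁-δ₂} = (q + (1-q)δ₁)(q + (1-q)δ₂)` -/

/-- `q^{1-δ} = q + (1-q)·δ` for `δ ∈ {0,1}`. [folklore] -/
theorem pow_one_sub_del (q : ℝ) {d : ℕ} (hd : d ≤ 1) : q ^ (1 - d) = q + (1 - q) * (d : ℝ) := by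
  interval_cases d <;> simp

/-- **Atom identity**: `q^{2-δ₁-δ₂} = (q + (1-q)δ₁)·(q + (1-q)δ₂)` for `δ₁, δ₂ ∈ {0,1}`; expanding gives the four atoms
`q²`, `q(1-q)δ₁`, `q(1-q)δ₂`, `(1-q)²δ₁δ₂` of memo §10.8. [folklore] -/
theorem pow_two_sub_del (q : ℝ) {d₁ d₂ : ℕ} (h₁ : d₁ ≤ 1) (h₂ : d₂ ≤ 1) :
    q ^ (2 - d₁ - d₂) = (q + (1 - q) * (d₁ : ℝ)) * (q + (1 - q) * (d₂ : ℝ)) := by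
  have h : 2 - d₁ - d₂ = (1 - d₁) + (1 - d₂) := by omega
  rw [h, pow_add, pow_one_sub_del q h₁, pow_one_sub_del q h₂]

/-- The four atoms expanded: `q^{2-δ₁-δ₂} = q² + q(1-q)(δ₁+δ₂) + (1-q)²δ₁δ₂`. [folklore] -/
theorem pow_two_sub_del_atoms (q : ℝ) {d₁ d₂ : ℕ} (h₁ : d₁ ≤ 1) (h₂ : d₂ ≤ 1) :
    q ^ (2 - d₁ - d₂) = q ^ 2 + q * (1 - q) * ((d₁ : ℝ) + d₂) + (1 - q) ^ 2 * ((d₁ : ℝ) * d₂) := by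
  rw [pow_two_sub_del q h₁ h₂]; ring

/-- Each atom weight is nonnegative on `[0, 1]`. [folklore] -/
theorem atom_nonneg {q : ℝ} (hq0 : 0 ≤ q) (hq1 : q ≤ 1) (a b : ℕ) : 0 ≤ (1 - q) ^ (a + b) * q ^ (2 - a - b) :=
  mul_nonneg (pow_nonneg (by linarith) _) (pow_nonneg hq0 _)

/-- **The cell of the root coefficient, atomised**: for `j` fixed,
`q^{2-δ₁-δ₂}·sign = (q² + q(1-q)(δ₁+δ₂) + (1-q)²δ₁δ₂)·sign`. [folklore] -/
theorem cell_atomised (q : ℝ) (j : Bool) (u v : List SLetter) :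
    q ^ (2 - cellDelA j u - cellDelB j v) * cellSign j u v =
      (q ^ 2 + q * (1 - q) * ((cellDelA j u : ℝ) + cellDelB j v) + (1 - q) ^ 2 * ((cellDelA j u : ℝ) * cellDelB j v)) *
        cellSign j u v := by
  rw [pow_two_sub_del_atoms q (cellDelA_le_one j u) (cellDelB_le_one j v)]

end TwoSpine

end FK

end Summit.CriticalPhenomena.PercolationContinuityZ3.Theorems
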